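import Summits.QuantumFields.YangMills.Theorems.UnitScaleTiltProp7CovariantBlockBumpsProfile
import Summits.QuantumFields.YangMills.Theorems.UnitScaleTiltProp7TubeTransportCloseness
import Summits.QuantumFields.YangMills.Theorems.UnitScaleTiltProp7LineAvgSmoothRightInverse
import Summits.QuantumFields.YangMills.Theorems.UnitScaleTiltProp7BondAvgIterCoercivity
import HarnessLib

/-!
# Route `UnitScaleTilt`, crux K1 «MinimiserStabilityRegPr» (stmt-QuantumFields-19200), EX face — K-storey (px12 g16 LOCATE-K137), pen (K1b-a) «transported right inverse of `Q_k(U₀)`»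
# (px13 g15; LOCATE `ym3-torus-px13/g15/LOCATE-K1b-a-px13g15.md`, 19200 evidence #43), FILE (F1) — **THE SKEW BUMP PROFILE AND ITS FLAT TUBE SUMS**: the one-dimensional profile
# `p(s) = (s + 1 − s₀)₊·(ℓ − s)` on the TOP quarter-slab `s ≥ s₀ := ℓ − (⌊ℓ∕4⌋ + 1)` of a block of side `ℓ = L^k` has SPILL ≤ OWN∕3 TERMWISE, explicit own mass
# `≥ (ℓ − ⌊ℓ∕4⌋)·ℓ₁(ℓ₁+1)(ℓ₁+2)∕6` (`ℓ₁ = ⌊ℓ∕4⌋ + 1`), `ℓ₁`-Lipschitz steps and face value `ℓ₁`; and the `(r,t)`-tube of a coarse bond splits into the OWN part (sites of its source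
# block, weight `s + 1`) and the SPILL part (sites of the next block, weight `ℓ − 1 − s`)

Cell `ym3-torus` (HUMAN RULING D-0037; rung R3 = SU(2) YM₃ on T³ — NOT d = 4, NOT infinite volume, NOT a mass gap, NOT Clay).  Width seat `ym3-torus-px13` (gen 15).  THEOREMS ONLY
(0 `def`, 0 `sorry`); `--supports stmt-QuantumFields-19200 --as helper`; count-neutral; pure lattice arithmetic, nothing of Bałaban's asserted.

WHY (LOCATE §3).  The flat tube average of the coarse bond `y = (z, μ)` weighs a `μ`-bond at `x ∈ B^k(z)` by `off_μ(x) + 1` and a `μ`-bond at `x ∈ B^k(z + e_μ)` by `ℓ − 1 − off_μ(x)`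
([Balaban1984PropagatorsI] (1.18): the one-stroke tube `Σ_{r}Σ_{t<ℓ} X(x_r + te_μ)`, ✓`sum_tube_eq_smul_bondAvgIter`); conversely the `μ`-bond at `x ∈ B^k(z)` is read by exactly the two
coarse bonds `(z, μ)` and `(z − e_μ, μ)` with those weights.  A bump for `y` supported on the `μ`-bonds of `B^k(z)` therefore spills into the average of `y − e_μ`; on the top quarter-slab
`3·(ℓ − 1 − s) ≤ s + 1`, so the spill is at most a third of the own mass for ANY non-negative profile there — the diagonal dominance px12 g16's Neumann step (✓`Prop7KinvVariationalRows`
§4: `‖Q(Ec) − c‖ ≤ ½‖c‖`) needs; tapers of slope `O(ℓ⁻¹)` at every face are what the `H¹` row (s2) needs (transverse taper = px10 g9's parabola ✓`Prop7CovariantBlockBumpsProfile.tau_*`).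

WHAT IS PROVED (ns `…Theorems.Prop7SkewBumpProfile`).
* §1 the one-dimensional skew profile (`ℓ ≥ 1` any): `skew_nonneg`, `skew_eq_zero_of_lt`, `skew_le`, `skew_last`, ★`three_mul_spill_le_own` (termwise), `abs_skew_succ_sub_le`,
  `sum_own_eq`∕★`sum_own_ge` (own mass `Σ_{s<ℓ}(s+1)p(s) ≥ (ℓ − ⌊ℓ∕4⌋)·ℓ₁(ℓ₁+1)(ℓ₁+2)∕6`, via ✓`six_mul_sum_bubble`), `three_mul_sum_spill_le_sum_own`.
* §2 the `(r,t)`-tube of a coarse bond (generic `P`, level `k ≤ m + K`): `runSite_fibreSite_eq_of_lt` ∕ `runSite_fibreSite_eq_of_ge` (the site `x_r + te_μ` as a block site of `z` resp.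
  `z + e_μ` with the shifted `μ`-offset), ★`sum_tube_split` (for any `g`: `Σ_rΣ_{t<ℓ} g(x_r + te_μ) = Σ_rΣ_{t<ℓ−r_μ} g(fibreSite z (r ↦_μ r_μ+t)) + Σ_rΣ_{ℓ−r_μ≤t<ℓ} g(fibreSite (z+e_μ) (r ↦_μ r_μ+t−ℓ))`).
HONEST SCOPE.  Arithmetic; the bump itself, row (a), (s1)∕(s2), (K1b), K137, EX and the crux are NOT proved here.

References: T. Bałaban, CMP **95** (1984) 17–40 [Balaban1984PropagatorsI] ((1.6)–(1.7) p.18, (1.11), (1.18) pp.19–20); CMP **102** (1985) 277–309 [Balaban1985Variational] ((45)–(46) p.285).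
-/

set_option autoImplicit false

noncomputable section

open scoped BigOperators

namespace Summit.QuantumFields.YangMills.Theorems.Prop7SkewBumpProfile

open Literature.MathematicalPhysics.QuantumFieldTheory.Balaban1983to89
open Finset T4Continuum BlockAveraging LatticeFieldCalculus B1RG242Torus
open B5Eq118OneStroke (iterBlockOf)
open Summit.QuantumFields.YangMills.Theorems.Prop7LineAvgSmoothRightInverse (six_mul_sum_bubble)
open Summit.QuantumFields.YangMills.Theorems.Prop7CombGauge (iterBlockOf_fibreSite)
open Summit.QuantumFields.YangMills.Theorems.Prop7FlatHolonomy (sitesPerDir_zero_eq_mul_pow)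
open Summit.QuantumFields.YangMills.Theorems.Prop7FlatCoercivity (fibreSite_runSite)

/-! ## §1 The one-dimensional skew profile `p(s) = (s + 1 − s₀)₊·(ℓ − s)`, `s₀ = ℓ − (⌊ℓ∕4⌋ + 1)` -/

section OneDim

/-- `p(s) ≥ 0` for `s < ℓ`. [folklore] -/
theorem skew_nonneg {ℓ s : ℕ} (hs : s < ℓ) : 0 ≤ ((s + 1 - (ℓ - (ℓ / 4 + 1)) : ℕ) : ℝ) * ((ℓ : ℝ) - s) := by
  have h : (s : ℝ) + 1 ≤ ℓ := by exact_mod_cast hs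
  exact mul_nonneg (Nat.cast_nonneg _) (by linarith)

/-- `p(s) = 0` below the top slab: `s + 1 ≤ s₀ ⟹ p(s) = 0`. [folklore] -/
theorem skew_eq_zero_of_lt {ℓ s : ℕ} (hs : s + 1 ≤ ℓ - (ℓ / 4 + 1)) : ((s + 1 - (ℓ - (ℓ / 4 + 1)) : ℕ) : ℝ) * ((ℓ : ℝ) - s) = 0 := by
  rw [Nat.sub_eq_zero_of_le hs, Nat.cast_zero, zero_mul]

/-- `p(s) ≤ ℓ₁²`, `ℓ₁ = ⌊ℓ∕4⌋ + 1` (both factors are `≤ ℓ₁` on the slab). [folklore] -/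
theorem skew_le {ℓ s : ℕ} (hs : s < ℓ) : ((s + 1 - (ℓ - (ℓ / 4 + 1)) : ℕ) : ℝ) * ((ℓ : ℝ) - s) ≤ (((ℓ / 4 + 1 : ℕ) : ℝ)) ^ 2 := by
  by_cases hcase : s + 1 ≤ ℓ - (ℓ / 4 + 1)
  · rw [skew_eq_zero_of_lt hcase]; positivity
  · have hcase' : ℓ - (ℓ / 4 + 1) < s + 1 := not_le.mp hcase
    have h4 : ℓ / 4 + 1 ≤ ℓ := by omega
    have h1 : s + 1 - (ℓ - (ℓ / 4 + 1)) ≤ ℓ / 4 + 1 := by omega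
    have h2 : ℓ - s ≤ ℓ / 4 + 1 := by omega
    have h1' : ((s + 1 - (ℓ - (ℓ / 4 + 1)) : ℕ) : ℝ) ≤ ((ℓ / 4 + 1 : ℕ) : ℝ) := by exact_mod_cast h1
    have h2' : ((ℓ : ℝ) - s) ≤ ((ℓ / 4 + 1 : ℕ) : ℝ) := by
      have : ((ℓ - s : ℕ) : ℝ) = (ℓ : ℝ) - s := by rw [Nat.cast_sub hs.le]
      rw [← this]; exact_mod_cast h2
    have hs' : (s : ℝ) + 1 ≤ ℓ := by exact_mod_cast hs
    have h0 : 0 ≤ (ℓ : ℝ) - s := by linarith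
    calc _ ≤ ((ℓ / 4 + 1 : ℕ) : ℝ) * ((ℓ / 4 + 1 : ℕ) : ℝ) := mul_le_mul h1' h2' h0 (Nat.cast_nonneg _)
      _ = _ := by ring

/-- The face value: `p(ℓ − 1) = ℓ₁` (`1 ≤ ℓ`). [folklore] -/
theorem skew_last {ℓ : ℕ} (hℓ : 1 ≤ ℓ) : ((ℓ - 1 + 1 - (ℓ - (ℓ / 4 + 1)) : ℕ) : ℝ) * ((ℓ : ℝ) - ((ℓ - 1 : ℕ) : ℝ)) = ((ℓ / 4 + 1 : ℕ) : ℝ) := by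
  have h4 : ℓ / 4 + 1 ≤ ℓ := by omega
  have h1 : ℓ - 1 + 1 - (ℓ - (ℓ / 4 + 1)) = ℓ / 4 + 1 := by omega
  rw [h1, Nat.cast_sub hℓ, Nat.cast_one]
  ring

/-- ★ **SPILL ≤ OWN∕3, TERMWISE**: `3·(ℓ − 1 − s)·p(s) ≤ (s + 1)·p(s)` for every `s < ℓ` (on the support `s ≥ s₀ = ℓ − (⌊ℓ∕4⌋ + 1)`: `3(ℓ − 1 − s) ≤ 3⌊ℓ∕4⌋ ≤ ℓ − ⌊ℓ∕4⌋ ≤ s + 1`).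
[cite: Balaban1984PropagatorsI, (1.18) p.20] -/
theorem three_mul_spill_le_own {ℓ s : ℕ} (hs : s < ℓ) :
    3 * (((ℓ : ℝ) - 1 - s) * (((s + 1 - (ℓ - (ℓ / 4 + 1)) : ℕ) : ℝ) * ((ℓ : ℝ) - s)))
      ≤ ((s : ℝ) + 1) * (((s + 1 - (ℓ - (ℓ / 4 + 1)) : ℕ) : ℝ) * ((ℓ : ℝ) - s)) := by
  by_cases hcase : s + 1 ≤ ℓ - (ℓ / 4 + 1)
  · rw [skew_eq_zero_of_lt hcase]; simp
  · have hcase' : ℓ - (ℓ / 4 + 1) < s + 1 := not_le.mp hcase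
    have hp := skew_nonneg hs
    have hkey : 3 * ((ℓ : ℝ) - 1 - s) ≤ (s : ℝ) + 1 := by
      have h1 : 3 * (ℓ - 1 - s) ≤ s + 1 := by omega
      have h2 : ((3 * (ℓ - 1 - s) : ℕ) : ℝ) ≤ ((s + 1 : ℕ) : ℝ) := by exact_mod_cast h1
      have h3 : ((ℓ - 1 - s : ℕ) : ℝ) = (ℓ : ℝ) - 1 - s := by
        rw [Nat.cast_sub (by omega), Nat.cast_sub (by omega), Nat.cast_one]
      push_cast at h2; rw [h3] at h2; exact h2
    calc 3 * (((ℓ : ℝ) - 1 - s) * (((s + 1 - (ℓ - (ℓ / 4 + 1)) : ℕ) : ℝ) * ((ℓ : ℝ) - s)))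
        = (3 * ((ℓ : ℝ) - 1 - s)) * (((s + 1 - (ℓ - (ℓ / 4 + 1)) : ℕ) : ℝ) * ((ℓ : ℝ) - s)) := by ring
      _ ≤ _ := mul_le_mul_of_nonneg_right hkey hp

/-- The slab steps: `|p(s+1) − p(s)| ≤ ℓ₁` for `s + 1 < ℓ`. [folklore] -/
theorem abs_skew_succ_sub_le {ℓ s : ℕ} (hs : s + 1 < ℓ) :
    |((s + 1 + 1 - (ℓ - (ℓ / 4 + 1)) : ℕ) : ℝ) * ((ℓ : ℝ) - ((s + 1 : ℕ) : ℝ)) - ((s + 1 - (ℓ - (ℓ / 4 + 1)) : ℕ) : ℝ) * ((ℓ : ℝ) - s)|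
      ≤ ((ℓ / 4 + 1 : ℕ) : ℝ) := by
  have h4 : ℓ / 4 + 1 ≤ ℓ := by omega
  by_cases hlt : s + 1 + 1 ≤ ℓ - (ℓ / 4 + 1)
  · rw [Nat.sub_eq_zero_of_le hlt, Nat.sub_eq_zero_of_le (by omega : s + 1 ≤ ℓ - (ℓ / 4 + 1))]
    simp only [Nat.cast_zero, zero_mul, sub_zero, abs_zero]
    positivity
  · have hlt' : ℓ - (ℓ / 4 + 1) < s + 1 + 1 := not_le.mp hlt
    by_cases heq : s + 1 ≤ ℓ - (ℓ / 4 + 1)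
    · -- entering the slab: `p(s) = 0`, `p(s+1) = 1·(ℓ − s − 1) ≤ ℓ₁`
      have hs0 : s + 1 = ℓ - (ℓ / 4 + 1) := by omega
      have hone : s + 1 + 1 - (ℓ - (ℓ / 4 + 1)) = 1 := by omega
      rw [Nat.sub_eq_zero_of_le heq, hone]
      have hs2 : (s : ℝ) + 1 + 1 ≤ ℓ := by exact_mod_cast hs
      have hcast : ((s + 1 : ℕ) : ℝ) = (ℓ : ℝ) - ((ℓ / 4 + 1 : ℕ) : ℝ) := by
        rw [hs0, Nat.cast_sub h4]
      push_cast at hcast ⊢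
      rw [zero_mul, sub_zero, one_mul, abs_of_nonneg (by linarith)]
      linarith
    · have heq' : ℓ - (ℓ / 4 + 1) < s + 1 := not_le.mp heq
      -- inside the slab: both factors in `[1, ℓ₁]`
      have ha : s + 1 + 1 - (ℓ - (ℓ / 4 + 1)) = (s + 1 - (ℓ - (ℓ / 4 + 1))) + 1 := by omega
      rw [ha]
      set a : ℕ := s + 1 - (ℓ - (ℓ / 4 + 1)) with ha_def
      have ha1 : 1 ≤ a := by omega
      have ha2 : a ≤ ℓ / 4 + 1 := by omega
      have hb1 : (s : ℝ) + 2 ≤ ℓ := by exact_mod_cast hs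
      have hb2 : ℓ - s ≤ ℓ / 4 + 1 := by omega
      have hb2' : (ℓ : ℝ) - s ≤ ((ℓ / 4 + 1 : ℕ) : ℝ) := by
        have hc : ((ℓ - s : ℕ) : ℝ) = (ℓ : ℝ) - s := by rw [Nat.cast_sub (by omega)]
        rw [← hc]; exact_mod_cast hb2
      have ha1' : (1 : ℝ) ≤ a := by exact_mod_cast ha1
      have ha2' : (a : ℝ) ≤ ((ℓ / 4 + 1 : ℕ) : ℝ) := by exact_mod_cast ha2
      push_cast
      have hexp : ((a : ℝ) + 1) * ((ℓ : ℝ) - ((s : ℝ) + 1)) - (a : ℝ) * ((ℓ : ℝ) - s) = ((ℓ : ℝ) - s) - a - 1 := by ring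
      rw [hexp, abs_le]
      push_cast at ha2' hb2'
      constructor <;> linarith

/-- **THE OWN MASS IN CLOSED FORM ON THE SLAB**: `Σ_{s<ℓ} (s+1)·p(s) = Σ_{j<ℓ₁} (j + s₀ + 1)·(j+1)·(ℓ₁ − j)` (re-indexing `s = s₀ + j`). [folklore] -/
theorem sum_own_eq (ℓ : ℕ) (hℓ : 1 ≤ ℓ) :
    ∑ s ∈ range ℓ, ((s : ℝ) + 1) * (((s + 1 - (ℓ - (ℓ / 4 + 1)) : ℕ) : ℝ) * ((ℓ : ℝ) - s))
      = ∑ j ∈ range (ℓ / 4 + 1), (((j + (ℓ - (ℓ / 4 + 1)) : ℕ) : ℝ) + 1) * ((((j : ℕ) : ℝ) + 1) * ((((ℓ / 4 + 1 : ℕ) : ℝ)) - j)) := by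
  have h4 : ℓ / 4 + 1 ≤ ℓ := by omega
  set s₀ : ℕ := ℓ - (ℓ / 4 + 1) with hs₀
  have hℓs : ℓ = s₀ + (ℓ / 4 + 1) := by omega
  conv_lhs => rw [hℓs, Finset.sum_range_add]
  have hzero : ∑ s ∈ range s₀, ((s : ℝ) + 1) * ((((s + 1 - s₀) : ℕ) : ℝ) * (((s₀ + (ℓ / 4 + 1) : ℕ) : ℝ) - s)) = 0 := by
    refine Finset.sum_eq_zero fun s hs => ?_
    rw [Finset.mem_range] at hs
    rw [Nat.sub_eq_zero_of_le (by omega : s + 1 ≤ s₀), Nat.cast_zero, zero_mul, mul_zero]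
  rw [hzero, zero_add]
  refine Finset.sum_congr rfl fun j hj => ?_
  rw [Finset.mem_range] at hj
  have h1 : s₀ + j + 1 - s₀ = j + 1 := by omega
  rw [h1, show j + s₀ = s₀ + j by omega]
  push_cast
  ring

/-- ★ **THE OWN MASS FROM BELOW**: `Σ_{s<ℓ} (s+1)·p(s) ≥ (ℓ − ⌊ℓ∕4⌋)·ℓ₁(ℓ₁+1)(ℓ₁+2)∕6` (`(s+1) ≥ s₀ + 1 = ℓ − ⌊ℓ∕4⌋` on the slab, then ✓`six_mul_sum_bubble`). [folklore] -/
theorem sum_own_ge (ℓ : ℕ) (hℓ : 1 ≤ ℓ) :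
    (((ℓ - ℓ / 4 : ℕ) : ℝ)) * ((((ℓ / 4 + 1 : ℕ) : ℝ)) * (((ℓ / 4 + 1 : ℕ) : ℝ) + 1) * (((ℓ / 4 + 1 : ℕ) : ℝ) + 2) / 6)
      ≤ ∑ s ∈ range ℓ, ((s : ℝ) + 1) * (((s + 1 - (ℓ - (ℓ / 4 + 1)) : ℕ) : ℝ) * ((ℓ : ℝ) - s)) := by
  rw [sum_own_eq ℓ hℓ]
  have h4 : ℓ / 4 + 1 ≤ ℓ := by omega
  have hbub := six_mul_sum_bubble (ℓ / 4 + 1)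
  have hs0 : (((ℓ - ℓ / 4 : ℕ) : ℝ)) = (((ℓ - (ℓ / 4 + 1)) : ℕ) : ℝ) + 1 := by
    have : ℓ - ℓ / 4 = (ℓ - (ℓ / 4 + 1)) + 1 := by omega
    rw [this]; push_cast; ring
  calc (((ℓ - ℓ / 4 : ℕ) : ℝ)) * ((((ℓ / 4 + 1 : ℕ) : ℝ)) * (((ℓ / 4 + 1 : ℕ) : ℝ) + 1) * (((ℓ / 4 + 1 : ℕ) : ℝ) + 2) / 6)
      = ((((ℓ - (ℓ / 4 + 1)) : ℕ) : ℝ) + 1) * ∑ s ∈ range (ℓ / 4 + 1), (((s : ℕ) : ℝ) + 1) * ((((ℓ / 4 + 1 : ℕ) : ℝ)) - s) := by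
        rw [hs0, ← hbub]; ring
    _ = ∑ j ∈ range (ℓ / 4 + 1), ((((ℓ - (ℓ / 4 + 1)) : ℕ) : ℝ) + 1) * ((((j : ℕ) : ℝ) + 1) * ((((ℓ / 4 + 1 : ℕ) : ℝ)) - j)) := by
        rw [Finset.mul_sum]
    _ ≤ _ := by
        refine Finset.sum_le_sum fun j hj => ?_
        rw [Finset.mem_range] at hj
        have hpos : 0 ≤ (((j : ℕ) : ℝ) + 1) * ((((ℓ / 4 + 1 : ℕ) : ℝ)) - j) := by
          have : (j : ℝ) + 1 ≤ ((ℓ / 4 + 1 : ℕ) : ℝ) := by exact_mod_cast hj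
          exact mul_nonneg (by positivity) (by linarith)
        refine mul_le_mul_of_nonneg_right ?_ hpos
        push_cast
        linarith [Nat.cast_nonneg (α := ℝ) j]

/-- **SPILL ≤ OWN∕3 IN TOTAL** (the termwise row summed). [cite: Balaban1984PropagatorsI, (1.18) p.20] -/
theorem three_mul_sum_spill_le_sum_own (ℓ : ℕ) :
    3 * ∑ s ∈ range ℓ, ((ℓ : ℝ) - 1 - s) * (((s + 1 - (ℓ - (ℓ / 4 + 1)) : ℕ) : ℝ) * ((ℓ : ℝ) - s))
      ≤ ∑ s ∈ range ℓ, ((s : ℝ) + 1) * (((s + 1 - (ℓ - (ℓ / 4 + 1)) : ℕ) : ℝ) * ((ℓ : ℝ) - s)) := by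
  rw [Finset.mul_sum]
  exact Finset.sum_le_sum fun s hs => three_mul_spill_le_own (Finset.mem_range.mp hs)

end OneDim

/-! ## §2 The `(r,t)`-tube of a coarse bond: own block and spill block -/

section Tube

variable {P : Params} {k : ℕ}

/-- **INSIDE THE SOURCE BLOCK**: for `r_μ + t < ℓ`, `x_r + te_μ = fibreSite z (r with r_μ ↦ r_μ + t)`. [cite: Balaban1984PropagatorsI, (1.6)-(1.7) p.18] -/
theorem runSite_fibreSite_eq_of_lt (z : Site P k) (r : Fin P.d → Fin (P.L ^ k)) (μ : Fin P.d) {t : ℕ} (ht : (r μ : ℕ) + t < P.L ^ k) :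
    runSite (Site.fibreSite 0 k z r) μ t = Site.fibreSite 0 k z (Function.update r μ ⟨r μ + t, ht⟩) := by
  funext ν
  by_cases hν : ν = μ
  · subst hν
    simp only [runSite, Site.fibreSite, Function.update_self]
    push_cast; ring
  · simp only [runSite, Site.fibreSite, Function.update_of_ne hν]

/-- **IN THE NEXT BLOCK**: for `ℓ ≤ r_μ + t < 2ℓ` (with `t ≤ ℓ`), `x_r + te_μ = fibreSite (z + e_μ) (r with r_μ ↦ r_μ + t − ℓ)` (standing range). [cite: Balaban1984PropagatorsI, (1.6)-(1.7) p.18] -/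
theorem runSite_fibreSite_eq_of_ge (hk : k ≤ P.m + P.K) (z : Site P k) (r : Fin P.d → Fin (P.L ^ k)) (μ : Fin P.d) {t : ℕ} (ht : t ≤ P.L ^ k)
    (hge : P.L ^ k ≤ (r μ : ℕ) + t) :
    runSite (Site.fibreSite 0 k z r) μ t
      = Site.fibreSite 0 k (z.shift μ) (Function.update r μ ⟨(r μ + t - P.L ^ k) % P.L ^ k, Nat.mod_lt _ (pow_pos P.L_pos k)⟩) := by
  have hmod : ((r μ : ℕ) + t - P.L ^ k) % P.L ^ k = (r μ : ℕ) + t - P.L ^ k := Nat.mod_eq_of_lt (by have := (r μ).isLt; omega)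
  have h : P.sitesPerDir 0 = P.L ^ k * P.sitesPerDir k := by rw [sitesPerDir_zero_eq_mul_pow hk, mul_comm]
  -- `fibreSite (z + e_μ) r' = fibreSite z r' + ℓ e_μ`
  have hrs : z.shift μ = runSite z μ 1 := by rw [runSite_succ, runSite_zero]
  rw [hrs, fibreSite_runSite h z μ 1]
  funext ν
  by_cases hν : ν = μ
  · subst hν
    simp only [runSite, Site.fibreSite, Function.update_self]
    rw [hmod]
    have hnat : ((r ν : ℕ) + t - P.L ^ k) + 1 * P.L ^ k = (r ν : ℕ) + t := by omega
    have hcast := congrArg (Nat.cast : ℕ → ZMod (P.sitesPerDir 0)) hnat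
    push_cast at hcast ⊢
    linear_combination (-1 : ZMod (P.sitesPerDir 0)) * hcast
  · simp only [runSite, Site.fibreSite, Function.update_of_ne hν]

/-- ★ **THE TUBE SPLITS INTO THE OWN BLOCK AND THE SPILL BLOCK**: for every `g` and every coarse bond `(z, μ)`,
`Σ_r Σ_{t<ℓ} g(x_r + te_μ) = Σ_r Σ_{t<ℓ} [r_μ + t < ℓ]·g(fibreSite z (r_μ ↦ r_μ+t)) + Σ_r Σ_{t<ℓ} [ℓ ≤ r_μ + t]·g(fibreSite (z+e_μ) (r_μ ↦ r_μ+t−ℓ))` (standing range).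
[cite: Balaban1984PropagatorsI, (1.18) p.20] -/
theorem sum_tube_split (hk : k ≤ P.m + P.K) {M : Type*} [AddCommMonoid M] (g : Site P 0 → M) (z : Site P k) (μ : Fin P.d) :
    ∑ r : Fin P.d → Fin (P.L ^ k), ∑ t ∈ range (P.L ^ k), g (runSite (Site.fibreSite 0 k z r) μ t)
      = ∑ r : Fin P.d → Fin (P.L ^ k), ∑ t ∈ range (P.L ^ k),
          (if ht : (r μ : ℕ) + t < P.L ^ k then g (Site.fibreSite 0 k z (Function.update r μ ⟨r μ + t, ht⟩)) else 0)
        + ∑ r : Fin P.d → Fin (P.L ^ k), ∑ t ∈ range (P.L ^ k),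
          (if (r μ : ℕ) + t < P.L ^ k then 0 else
            g (Site.fibreSite 0 k (z.shift μ) (Function.update r μ ⟨(r μ + t - P.L ^ k) % P.L ^ k, Nat.mod_lt _ (pow_pos P.L_pos k)⟩))) := by
  rw [← Finset.sum_add_distrib]
  refine Finset.sum_congr rfl fun r _ => ?_
  rw [← Finset.sum_add_distrib]
  refine Finset.sum_congr rfl fun t ht' => ?_
  have htℓ : t < P.L ^ k := Finset.mem_range.mp ht'
  by_cases ht : (r μ : ℕ) + t < P.L ^ k
  · rw [dif_pos ht, if_pos ht, add_zero, runSite_fibreSite_eq_of_lt z r μ ht]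
  · rw [dif_neg ht, if_neg ht, zero_add, runSite_fibreSite_eq_of_ge hk z r μ htℓ.le (not_lt.mp ht)]

end Tube

end Summit.QuantumFields.YangMills.Theorems.Prop7SkewBumpProfile

end
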